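import Literature.AlgebraicGeometry.Motives.AimedSplitProduct
import Literature.AlgebraicGeometry.HodgeTheory.WeilClassesProducts
import Literature.AlgebraicGeometry.HodgeTheory.ComplexBettiKunneth
import Literature.AlgebraicGeometry.HodgeTheory.GlobalInvariantCyclesProofs
import Literature.AlgebraicGeometry.HodgeTheory.MiddleDimensionReductionOfHodgeModels
import Literature.AlgebraicGeometry.HodgeTheory.HodgeTypeExteriorProduct
import Literature.AlgebraicGeometry.HodgeTheory.HodgeTypeConjugation
import Literature.AlgebraicGeometry.HodgeTheory.TorusRationalClasses
import Literature.AlgebraicGeometry.HodgeTheory.TopDegreeClasses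
import Literature.AlgebraicGeometry.HodgeTheory.HodgeConjectureQbarVoisinProofs
import Literature.AlgebraicGeometry.Motives.AbelianVarietyProjectiveChart
import Literature.AlgebraicGeometry.Motives.AbelianVarietyProductDimProofs
import Literature.AlgebraicGeometry.Motives.VarietiesDimensionProofs
import Literature.NumberTheory.EllipticCurves.ComplexTorusAnalytification
import Literature.NumberTheory.EllipticCurves.AbelianVarietyBridgeFullProofs
import Literature.AlgebraicTopology.SingularHomology.CupProductProofs
import HarnessLib

/-!
# A Weil surface with a descent pair, for every `d` (the surface-side computation of the product trick, proved)

Family `hodge`, layer `Literature/AlgebraicGeometry/Motives`. Theorems-only companion of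
`Motives/AimedSplitProduct` (the named fact `exists_cmWeilSurface_aimedSplitProduct`, misstated for
`d ∈ {1, 3}` in its AIMING half, and the corrected statement recorded there as the conclusion of
`exists_cmWeilSurface_aimedSplitProduct.of_ne_one_of_ne_three`). Both versions open with a SURFACE
conjunct — a complex abelian surface `(B, ψ)`, `ψ ≫ ψ = -d`, with a DESCENT PAIR. This file proves,
for every `d`, that such a pair `(B, ψ)` with a descent pair EXISTS, in the typing of that conjunct:

* `exists_weilSurface_descentPair` — **for every `d` there is a complex abelian surface `B` with an
  endomorphism `ψ`, `ψ ≫ ψ = -d`, classes `b₊ ∈ Eig((𝟙+ψ)^*, (1+i√d)²)`, `b₋ ∈ Eig((𝟙+ψ)^*, (1-i√d)²)`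
  in `H²(B(ℂ); ℂ)` with `b₊ + b₋` rational of Hodge type `(1,1)`, and an ALGEBRAIC class
  `η ∈ N¹H²(B(ℂ); ℂ)` with `b₊ ⌣ η ≠ 0` and `b₋ ⌣ η ≠ 0` in `H⁴(B(ℂ); ℂ)`.**

This is the cohomological content of Schoen's partner surface `A'` in the product step (C. Schoen,
Compositio Math. 114 (1998), §10, proof of the Proposition, p. 333: "`W_{A'}` has Hodge type
`(1,1)`", "`W_{A'}` is generated by cohomology classes of divisors", and "`ω_{5,σ₁} ∧ ω_{6,σ₁} ∧
ω_{5,σ₂} ∧ ω_{6,σ₂}` is a basis for `H⁴(A'; ℂ)`" — the products of the two Weil lines with a divisor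
class do not vanish), carried out in the companion-matrix model of the tree's
`HodgeTheory/WeilClassesSurfacesProofs` (no complex multiplication is used: `K = ℚ(√-d) ↪ M₂(ℚ) ⊆
End⁰(E × E)` for ANY complex elliptic curve `E`; B. van Geemen, LNM 1594 (1994), Def. 4.9, Lemma 5.2 (6)):

* `B = E × E` for the complex elliptic curve `E` of `HodgeTheory.exists_abelianVariety_dim_one_cupProduct_ne_zero`
  (classes `α, β ∈ H¹(E(ℂ); ℂ)` with `ω = α ∪ β ≠ 0` rational), `ψ = (-(d • snd), fst)`, `ψ ≫ ψ = -d`;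
* `b_± = u_±(α) ∪ u_±(β)`, `u_±(a) = fst^* a ± i√d · snd^* a` the simultaneous eigenclasses of all
  `(x·𝟙 + y·ψ)^*` (`map_fst_add_smul_map_snd_mem_pullbackEigenclasses`, `cupProduct_mem_pullbackEigenclasses`),
  in particular `(𝟙+ψ)^* b_± = (1 ± i√d)² b_±`; `b₊ + b₋ = 2·fst^*ω - 2d·snd^*ω` is rational of type
  `(1,1)` (as in `exists_weilClass_prod_self_of_dim_one`);
* `η = snd^* ω`, ALGEBRAIC: `ω ∈ N¹H²(E)` because every top-degree class of a smooth projective curve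
  is algebraic (`mem_algebraicClasses_of_degree_top`, the class of a point), and the flat pull-back
  `snd^*` preserves `N¹` (`map_mem_algebraicClasses_of_flat`) — in print `η = [E × pt]`;
* `b_± ⌣ η = fst^*ω ∪ snd^*ω` (`cupProduct_weilComponent_map_snd`: the terms through `snd^*(β ∪ ω)`,
  `snd^*(α ∪ ω) ∈ snd^* H³(E(ℂ)) = 0` die, by associativity and graded commutativity of `∪`,
  `cupProduct_assoc`, `cupProduct_gradedComm_holds`), and `fst^*ω ∪ snd^*ω ≠ 0` by the UNIQUENESS
  half of the Künneth theorem (`complexBetti_kunneth_bijective`; `cupProduct_map_fst_map_snd_ne_zero`: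
  `fst^* x ∪ snd^* y ≠ 0` for `x ≠ 0`, `y ≠ 0`, Hatcher Thm. 3.16).

CAVEAT (scope). This file does not touch the AIMING half, and it does NOT show that this `(B, ψ)`
can serve as the surface of the aiming fact: there `B` must in addition carry, for every Weil-type
`(A, φ)`, a `K`-compatible polarization of prescribed discriminant class, which is a condition on the
`K`-compatible Néron–Severi classes of `E × E` — on the printed CM witness `E = ℂ/O_K`,
`ψ = (√-d) × (-√-d)` the classes `m₁E₀ ⊞ m₂E₀` realise every class `-q` (van Geemen 5.2 (3), 5.3),
whereas for a curve `E` WITHOUT complex multiplication and `ψ = (-(d • snd), fst)` the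
`K`-compatible symmetric classes `[[x, y], [y, z]]`, `y ∈ End E = ℤ`, are only the multiples
`x · (E₀ ⊞ d E₀)` (`ψᵀ λ ψ = d λ` forces `y = 0`, `z = d x`), a single discriminant class. The
descent-pair COMPUTATION (`cupProduct_weilComponent_map_snd`, `cupProduct_map_fst_map_snd_ne_zero`,
the algebraicity of `snd^* ω`) is stated for an arbitrary one-dimensional `E` and transfers verbatim
to the CM witness once it is available as an `AbelianVariety ℂ` with `√-d ∈ End E`.

## Prelude: the companion surface `(E × E, ψ)` on the carriers (re-landed)

The degree-one tools this construction needs were proved in the 2026-08-16T08:51Z version of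
`HodgeTheory/WeilClassesSurfacesProofs` and disappeared when that file was re-landed with a torus-model
proof (p93879); they are re-proved here, unchanged, in their original namespace
`Literature.AlgebraicGeometry.HodgeTheory`: pull-back on `H¹(A(ℂ); ℂ)` is ADDITIVE in the
homomorphism (`complexBetti_map_one_deg_one`, `exists_eq_map_fst_add_map_snd_deg_one` — Künneth in
degree one —, `complexBetti_map_mul_deg_one` — degree-one classes are primitive, Mumford §1 —,
`complexBetti_map_hom_mul_deg_one`, `complexBetti_map_add/nsmul/neg/zero_deg_one`), the eigenclasses
`u_ν(a) = fst^* a + ν · snd^* a` of all test endomorphisms `(x·𝟙 + y·ψ)^*` of `(E × E, ψ)`,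
`ψ = (-(d • snd), fst)` (`map_fst_add_smul_map_snd_mem_pullbackEigenclasses`), and a complex elliptic
curve `E` (the Weierstrass cubic of `ℤ + iℤ`, `WeierstrassCurve.abelianVarietyOfAddHom`) with classes
`α, β ∈ H¹(E(ℂ); ℂ)`, `α ∪ β ≠ 0` rational, from the torus `E(ℂ) ≃ₜ (ℝ/ℤ)²`
(`exists_abelianVariety_dim_one_cupProduct_ne_zero`).

Everything is proved; no definition, no named fact (D-0026). Relies on: nothing unproved.

## References

* [MumfordAV1970] D. Mumford, *Abelian Varieties* (1970), §1 (cohomology of complex tori, `H¹` primitive).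
* [LangeBirkenhake1992] H. Lange, Ch. Birkenhake, *Complex Abelian Varieties* (1992), 1.1.2, Lemma 1.1.17.
* [SilvermanAEC2009] J. H. Silverman, *The Arithmetic of Elliptic Curves* (2009), III.3.6, VI.3.6 (b).
* [VoisinHodgeI2002] C. Voisin, *Hodge Theory and Complex Algebraic Geometry I* (2002), §7.3.2.

* [Schoen1998HodgeWeilAddendum] C. Schoen, Compositio Math. 114 (1998) 329–336, §10 (p. 333).
* [vanGeemen1994HodgeAV] B. van Geemen, LNM 1594 (1994), Def. 4.9, Lemma 5.2 (6).
* [Markman2025SurveySecant] E. Markman, arXiv:2509.23403, §11.5 Step 2 (the polarized abelian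
  surface of Weil type `(A₂, η₂, h₂)` of the product step).
* [HatcherAT2002] A. Hatcher, *Algebraic Topology* (2002), §3.2 Prop. 3.10, Thm. 3.16.
-/

noncomputable section

open CategoryTheory AlgebraicGeometry MonoidalCategory CartesianMonoidalCategory
open Literature.AlgebraicGeometry.Motives
open Literature.AlgebraicTopology.SingularHomology

/-! ## Prelude (namespace `HodgeTheory`): additivity on `H¹`, the companion surface, a curve -/

namespace Literature.AlgebraicGeometry.HodgeTheory

/-! ### Pull-back on `H¹(A(ℂ); ℂ)` is additive in the homomorphism -/

section Additive

open scoped MonObj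

/-- **The trivial homomorphism kills `H¹`**: for the constant map `1 = toUnit T ≫ η : T ⟶ A` at the
neutral element of a `ℂ`-group scheme `A`, `1^* = 0` on `H¹(A(ℂ); ℂ)`, since `1` factors through
`Spec ℂ`, a point, and `H¹(pt; ℂ) = 0` (`subsingleton_complexBetti` for the smooth projective `0`-fold
`𝟙_ (SchemeOver ℂ)`, `isSmoothProjective_unit_holds`). [cite: MumfordAV1970, §1] -/
theorem complexBetti_map_one_deg_one {T A : SchemeOver ℂ} [MonObj A] (v : complexBetti A 1) :
    complexBetti.map (1 : T ⟶ A) 1 v = 0 := by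
  haveI : Subsingleton (complexBetti (𝟙_ (SchemeOver ℂ)) 1) :=
    subsingleton_complexBetti (isSmoothProjective_unit_holds ℂ) (by norm_num)
  rw [Hom.one_def, complexBetti.map_comp, CategoryTheory.comp_apply,
    Subsingleton.elim (complexBetti.map η[A] 1 v) 0, map_zero]

/-- **Künneth in degree one for the complex points of a product of smooth projective varieties**:
every class `z ∈ H¹((Y ⊗ Z)(ℂ); ℂ)` is `fst^* a + snd^* b` for some `a ∈ H¹(Y(ℂ); ℂ)`,
`b ∈ H¹(Z(ℂ); ℂ)` (the tree's Künneth theorem `complexBetti_kunneth_bijective`, Hatcher Thm. 3.16, in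
degree `1`, with `H⁰ = ℂ · 1` on the path-connected `Y(ℂ)`, `Z(ℂ)` and the unit laws of `∪`).
[cite: HatcherAT2002, §3.2 Thm. 3.16] -/
theorem exists_eq_map_fst_add_map_snd_deg_one {m n : ℕ} {Y Z : SchemeOver ℂ}
    (hY : IsSmoothProjective m Y) (hZ : IsSmoothProjective n Z) (z : complexBetti (Y ⊗ Z) 1) :
    ∃ (a : complexBetti Y 1) (b : complexBetti Z 1),
      z = complexBetti.map (fst Y Z) 1 a + complexBetti.map (snd Y Z) 1 b := by
  classical
  haveI := pathConnectedSpace_complexPoints hY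
  haveI := pathConnectedSpace_complexPoints hZ
  haveI := fun j ↦ finite_complexBetti hZ j
  set S : Submodule ℂ (complexBetti (Y ⊗ Z) 1) := LinearMap.range (complexBetti.map (fst Y Z) 1).hom ⊔
    LinearMap.range (complexBetti.map (snd Y Z) 1).hom
  suffices h : z ∈ S by
    obtain ⟨x, hx, y, hy, hxy⟩ := Submodule.mem_sup.1 h
    obtain ⟨a, rfl⟩ := LinearMap.mem_range.1 hx
    obtain ⟨b, rfl⟩ := LinearMap.mem_range.1 hy
    exact ⟨a, b, hxy.symm⟩
  have hcross : ∀ {p q : ℕ} (h : p + q = 1) (a : complexBetti Y p) (w : complexBetti Z q),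
      cupProduct h (complexBetti.map (fst Y Z) p a) (complexBetti.map (snd Y Z) q w) ∈ S := by
    intro p q h a w
    obtain ⟨rfl, rfl⟩ | ⟨rfl, rfl⟩ : p = 0 ∧ q = 1 ∨ p = 1 ∧ q = 0 := by omega
    · obtain ⟨c, rfl⟩ := singularCohomology.exists_eq_smul_one a
      rw [map_smul, singularCohomology.map_one, LinearMap.map_smul₂, one_cupProduct]
      exact Submodule.mem_sup_right (Submodule.smul_mem _ _ (LinearMap.mem_range_self _ w))
    · obtain ⟨c, rfl⟩ := singularCohomology.exists_eq_smul_one w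
      rw [map_smul, singularCohomology.map_one, LinearMap.map_smul, cupProduct_one]
      exact Submodule.mem_sup_left (Submodule.smul_mem _ _ (LinearMap.mem_range_self _ a))
  obtain ⟨a, rfl⟩ := (complexBetti_kunneth_bijective hY hZ
    (fun j ↦ Module.finBasis ℂ (complexBetti Z j)) 1).2 z
  rw [LerayHirsch.lhMap_apply]
  refine Submodule.sum_mem _ fun j _ ↦ ?_
  split_ifs with h
  · exact hcross _ _ _
  · exact Submodule.zero_mem _

/-- **Degree-one classes of a complex abelian variety are primitive**: for the group law
`m = μ[A.X] : A ⊗ A ⟶ A`, `m^* v = fst^* v + snd^* v` in `H¹((A ⊗ A)(ℂ); ℂ)` (Mumford §1: `H•(A)` is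
a Hopf algebra and `H¹` is primitive; pull back the Künneth expansion `m^* v = fst^* a + snd^* b` along
the sections `(𝟙, 1)`, `(1, 𝟙)`). [cite: MumfordAV1970, §1] -/
theorem complexBetti_map_mul_deg_one (A : AbelianVariety ℂ) (v : complexBetti A.X 1) :
    complexBetti.map μ[A.X] 1 v =
      complexBetti.map (fst A.X A.X) 1 v + complexBetti.map (snd A.X A.X) 1 v := by
  have hA : IsSmoothProjective A.dim A.X := AbelianVariety.isSmoothProjective_holds
  obtain ⟨a, b, hab⟩ := exists_eq_map_fst_add_map_snd_deg_one hA hA (complexBetti.map μ[A.X] 1 v)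
  have e₁ : lift (𝟙 A.X) (1 : A.X ⟶ A.X) ≫ μ[A.X] = 𝟙 A.X := by rw [← Hom.mul_def, mul_one]
  have e₂ : lift (1 : A.X ⟶ A.X) (𝟙 A.X) ≫ μ[A.X] = 𝟙 A.X := by rw [← Hom.mul_def, one_mul]
  have ha : v = a := by
    have h := congrArg (complexBetti.map (lift (𝟙 A.X) (1 : A.X ⟶ A.X)) 1) hab
    rwa [map_add, ← CategoryTheory.comp_apply, ← complexBetti.map_comp, e₁, complexBetti.map_id,
      CategoryTheory.id_apply, ← CategoryTheory.comp_apply, ← complexBetti.map_comp, lift_fst,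
      complexBetti.map_id, CategoryTheory.id_apply, ← CategoryTheory.comp_apply,
      ← complexBetti.map_comp, lift_snd, complexBetti_map_one_deg_one, add_zero] at h
  have hb : v = b := by
    have h := congrArg (complexBetti.map (lift (1 : A.X ⟶ A.X) (𝟙 A.X)) 1) hab
    rwa [map_add, ← CategoryTheory.comp_apply, ← complexBetti.map_comp, e₂, complexBetti.map_id,
      CategoryTheory.id_apply, ← CategoryTheory.comp_apply, ← complexBetti.map_comp, lift_fst,
      complexBetti_map_one_deg_one, zero_add, ← CategoryTheory.comp_apply,
      ← complexBetti.map_comp, lift_snd, complexBetti.map_id, CategoryTheory.id_apply] at h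
  rw [hab, ← ha, ← hb]

/-- **`(p · q)^* v = p^* v + q^* v` on `H¹(A(ℂ); ℂ)`** for `ℂ`-morphisms `p q : T ⟶ A` into a complex
abelian variety, `p · q = lift p q ≫ m` their pointwise product (primitivity and functoriality; the
`complexBetti` twin of the tree's `Motives.WeilCohomology.pullback_mul_deg_one`). [cite: MumfordAV1970, §1] -/
theorem complexBetti_map_hom_mul_deg_one (A : AbelianVariety ℂ) {T : SchemeOver ℂ}
    (p q : T ⟶ A.X) (v : complexBetti A.X 1) :
    complexBetti.map (p * q) 1 v = complexBetti.map p 1 v + complexBetti.map q 1 v := by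
  rw [Hom.mul_def, complexBetti.map_comp, CategoryTheory.comp_apply, complexBetti_map_mul_deg_one,
    map_add, ← CategoryTheory.comp_apply, ← complexBetti.map_comp, lift_fst,
    ← CategoryTheory.comp_apply, ← complexBetti.map_comp, lift_snd]

end Additive

section Homomorphisms

open scoped MonObj

variable {T A : AbelianVariety ℂ}

/-- **Pull-back on `H¹` is additive in the homomorphism**: `(f + g)^* = f^* + g^*` on `H¹(A(ℂ); ℂ)` for
homomorphisms `f, g : T ⟶ A` of complex abelian varieties (`f + g` is the pointwise product,
`AbelianVariety.hom_add`; Lange–Birkenhake 1.1.2: the rational representation is additive, and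
Lemma 1.1.17 (a): `H¹ = Hom(Λ, ℤ)`). [cite: LangeBirkenhake1992, 1.1.2 and Lemma 1.1.17 (a)] -/
theorem complexBetti_map_add_deg_one (f g : T ⟶ A) (v : complexBetti A.X 1) :
    complexBetti.map (f + g).hom.hom.hom 1 v =
      complexBetti.map f.hom.hom.hom 1 v + complexBetti.map g.hom.hom.hom 1 v := by
  change complexBetti.map (f.hom.hom.hom * g.hom.hom.hom) 1 v = _
  exact complexBetti_map_hom_mul_deg_one A _ _ v

/-- The zero homomorphism kills `H¹`: `0^* = 0` on `H¹(A(ℂ); ℂ)` (`(0 : T ⟶ A)` is the trivial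
homomorphism `1`, `AbelianVariety.hom_zero`). [cite: MumfordAV1970, §1] -/
theorem complexBetti_map_zero_deg_one (v : complexBetti A.X 1) :
    complexBetti.map (0 : T ⟶ A).hom.hom.hom 1 v = 0 := by
  change complexBetti.map (1 : T.X ⟶ A.X) 1 v = 0
  exact complexBetti_map_one_deg_one v

/-- `(n • f)^* = n • f^*` on `H¹(A(ℂ); ℂ)`. [cite: LangeBirkenhake1992, 1.1.2 and Lemma 1.1.17 (a)] -/
theorem complexBetti_map_nsmul_deg_one (n : ℕ) (f : T ⟶ A) (v : complexBetti A.X 1) :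
    complexBetti.map (n • f).hom.hom.hom 1 v = n • complexBetti.map f.hom.hom.hom 1 v := by
  induction n with
  | zero => rw [zero_smul, zero_smul, complexBetti_map_zero_deg_one]
  | succ n ih => rw [succ_nsmul, complexBetti_map_add_deg_one, ih, succ_nsmul]

/-- `(-f)^* = -f^*` on `H¹(A(ℂ); ℂ)`. [cite: LangeBirkenhake1992, 1.1.2 and Lemma 1.1.17 (a)] -/
theorem complexBetti_map_neg_deg_one (f : T ⟶ A) (v : complexBetti A.X 1) :
    complexBetti.map (-f).hom.hom.hom 1 v = -complexBetti.map f.hom.hom.hom 1 v := by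
  have h := complexBetti_map_add_deg_one (-f) f v
  rw [neg_add_cancel, complexBetti_map_zero_deg_one] at h
  exact eq_neg_of_add_eq_zero_left h.symm

/-- Contravariance along homomorphisms: `f^* (g^* c) = (f ≫ g)^* c`. [folklore] -/
theorem complexBetti_map_map_hom {A B C : AbelianVariety ℂ} {k : ℕ} (f : A ⟶ B) (g : B ⟶ C)
    (c : complexBetti C.X k) :
    complexBetti.map f.hom.hom.hom k (complexBetti.map g.hom.hom.hom k c) =
      complexBetti.map (f ≫ g).hom.hom.hom k c := by
  change _ = complexBetti.map (f.hom.hom.hom ≫ g.hom.hom.hom) k c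
  rw [complexBetti.map_comp, CategoryTheory.comp_apply]

end Homomorphisms

/-! ### The Weil eigenclasses of `(E × E, ψ)`, `ψ = (-(d • snd), fst)` -/

section Companion

variable {E : AbelianVariety ℂ} {d : ℕ} {ψ : E.prod E ⟶ E.prod E}

/-- `(x·𝟙 + y·ψ) ≫ fst = x·fst - yd·snd` for `ψ ≫ fst = -d·snd` (composition is bilinear). [folklore] -/
theorem prodSelf_nsmul_id_add_nsmul_comp_fst (h₁ : ψ ≫ AbelianVariety.fst E E = -(d • AbelianVariety.snd E E))
    (x y : ℕ) :
    (x • 𝟙 (E.prod E) + y • ψ) ≫ AbelianVariety.fst E E =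
      x • AbelianVariety.fst E E + -((y * d) • AbelianVariety.snd E E) := by
  rw [Preadditive.add_comp, Preadditive.nsmul_comp, Preadditive.nsmul_comp, Category.id_comp, h₁,
    neg_nsmul, mul_nsmul']

/-- `(x·𝟙 + y·ψ) ≫ snd = x·snd + y·fst` for `ψ ≫ snd = fst`. [folklore] -/
theorem prodSelf_nsmul_id_add_nsmul_comp_snd (h₂ : ψ ≫ AbelianVariety.snd E E = AbelianVariety.fst E E)
    (x y : ℕ) :
    (x • 𝟙 (E.prod E) + y • ψ) ≫ AbelianVariety.snd E E =
      x • AbelianVariety.snd E E + y • AbelianVariety.fst E E := by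
  rw [Preadditive.add_comp, Preadditive.nsmul_comp, Preadditive.nsmul_comp, Category.id_comp, h₂]

/-- **The degree-one eigenclasses of `(E × E, ψ)`**: for `ψ ≫ fst = -d·snd`, `ψ ≫ snd = fst` and
`ν² = -d`, the class `u_ν(a) = fst^* a + ν · snd^* a ∈ H¹((E × E)(ℂ); ℂ)` satisfies
`(x·𝟙 + y·ψ)^* u_ν(a) = (x + yν) · u_ν(a)` for all `x, y` — the two eigenspaces `V_{±i√d}` of `ψ^*`
on `H¹ = V ⊕ V`, each containing holomorphic and antiholomorphic classes of `E` (signature `(1,1)`: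
`(E × E, ℚ(ψ))` is of Weil type, van Geemen Def. 4.9). [cite: vanGeemen1994HodgeAV, 4.9 and Lemma 5.2 (6)] -/
theorem map_fst_add_smul_map_snd_mem_pullbackEigenclasses
    (h₁ : ψ ≫ AbelianVariety.fst E E = -(d • AbelianVariety.snd E E))
    (h₂ : ψ ≫ AbelianVariety.snd E E = AbelianVariety.fst E E) {ν : ℂ} (hν : ν * ν = -(d : ℂ))
    (a : complexBetti E.X 1) :
    complexBetti.map (AbelianVariety.fst E E).hom.hom.hom 1 a +
        ν • complexBetti.map (AbelianVariety.snd E E).hom.hom.hom 1 a ∈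
      pullbackEigenclasses (E.prod E) ψ 1 fun x y ↦ (x : ℂ) + (y : ℂ) * ν := by
  rw [mem_pullbackEigenclasses_iff]
  intro x y
  have eF : complexBetti.map (x • 𝟙 (E.prod E) + y • ψ).hom.hom.hom 1
      (complexBetti.map (AbelianVariety.fst E E).hom.hom.hom 1 a) =
      (x : ℂ) • complexBetti.map (AbelianVariety.fst E E).hom.hom.hom 1 a +
        -(((y * d : ℕ) : ℂ) • complexBetti.map (AbelianVariety.snd E E).hom.hom.hom 1 a) := by
    rw [complexBetti_map_map_hom, prodSelf_nsmul_id_add_nsmul_comp_fst h₁, complexBetti_map_add_deg_one,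
      complexBetti_map_nsmul_deg_one, complexBetti_map_neg_deg_one, complexBetti_map_nsmul_deg_one,
      Nat.cast_smul_eq_nsmul ℂ, Nat.cast_smul_eq_nsmul ℂ]
  have eS : complexBetti.map (x • 𝟙 (E.prod E) + y • ψ).hom.hom.hom 1
      (complexBetti.map (AbelianVariety.snd E E).hom.hom.hom 1 a) =
      (x : ℂ) • complexBetti.map (AbelianVariety.snd E E).hom.hom.hom 1 a +
        (y : ℂ) • complexBetti.map (AbelianVariety.fst E E).hom.hom.hom 1 a := by
    rw [complexBetti_map_map_hom, prodSelf_nsmul_id_add_nsmul_comp_snd h₂, complexBetti_map_add_deg_one,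
      complexBetti_map_nsmul_deg_one, complexBetti_map_nsmul_deg_one, Nat.cast_smul_eq_nsmul ℂ,
      Nat.cast_smul_eq_nsmul ℂ]
  change complexBetti.map (x • 𝟙 (E.prod E) + y • ψ).hom.hom.hom 1 _ = _
  rw [map_add, map_smul, eF, eS]
  push_cast
  match_scalars <;> first | ring1 | linear_combination (-(y : ℂ)) * hν

/-- The bilinear identity behind `b₊ + b₋`: `c(F + νS, F' + νS') + c(F - νS, F' - νS') =
2·c(F, F') + 2ν²·c(S, S')` (the cross terms cancel). [folklore] -/
theorem bilin_add_bilin_neg {M N P : Type*} [AddCommGroup M] [Module ℂ M] [AddCommGroup N]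
    [Module ℂ N] [AddCommGroup P] [Module ℂ P] (c : M →ₗ[ℂ] N →ₗ[ℂ] P) (ν : ℂ) (F S : M)
    (F' S' : N) :
    c (F + ν • S) (F' + ν • S') + c (F + (-ν) • S) (F' + (-ν) • S') =
      (2 : ℂ) • c F F' + (2 * (ν * ν)) • c S S' := by
  simp only [map_add, map_smul, map_neg, LinearMap.add_apply, LinearMap.smul_apply,
    LinearMap.neg_apply, neg_smul, smul_add, smul_neg, smul_smul]
  module

/-- `(i√d)² = -d` in `ℂ`. [folklore] -/
theorem I_mul_sqrt_mul_self (d : ℕ) :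
    (Complex.I * (Real.sqrt d : ℂ)) * (Complex.I * (Real.sqrt d : ℂ)) = -(d : ℂ) := by
  have h : ((Real.sqrt d : ℝ) : ℂ) * (Real.sqrt d : ℂ) = (d : ℂ) := by
    rw [← Complex.ofReal_mul, Real.mul_self_sqrt (Nat.cast_nonneg d), Complex.ofReal_natCast]
  linear_combination (Real.sqrt d : ℂ) * (Real.sqrt d : ℂ) * Complex.I_mul_I - h

end Companion

/-! ### A complex elliptic curve with `H¹ ∪ H¹ ≠ 0`, from the torus -/

section Curve

/-- `1, i` are `ℝ`-linearly independent. [folklore] -/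
theorem linearIndependent_one_I : LinearIndependent ℝ ![(1 : ℂ), Complex.I] := by
  refine LinearIndependent.pair_iff.mpr fun s t hst ↦ ?_
  rw [Complex.real_smul, Complex.real_smul, mul_one] at hst
  have him : t = 0 := by simpa using congrArg Complex.im hst
  have hre : s = 0 := by simpa [him] using congrArg Complex.re hst
  exact ⟨hre, him⟩

/-- **A space homeomorphic to the `2`-torus carries degree-one classes with `α ∪ β ≠ 0` rational**:
transport the coordinate classes `ξ₀, ξ₁ ∈ H¹(T²)` — `ξ₀ ∪ ξ₁ ≠ 0` (Hatcher Example 3.16,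
`torusTop_ne_zero`), the class of an integer-valued cocycle (`isRationalClass_torusMonomial`) — along
the homeomorphism (naturality of `∪`, Prop. 3.10). [cite: HatcherAT2002, §3.2 Prop. 3.10 and Example 3.16] -/
theorem exists_cupProduct_ne_zero_of_homeomorph {Y : Type} [TopologicalSpace Y] (φ : Torus 2 ≃ₜ Y) :
    ∃ α β : singularCohomology ℂ ℂ Y 1,
      cupProduct (show 1 + 1 = 2 * 1 by norm_num) α β ≠ 0 ∧
        IsRationalClass (cupProduct (show 1 + 1 = 2 * 1 by norm_num) α β) := by
  have hid : singularCohomology.map ℂ ℂ (φ.symm : C(Y, Torus 2)) (2 * 1) ≫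
      singularCohomology.map ℂ ℂ (φ : C(Torus 2, Y)) (2 * 1) = 𝟙 _ := by
    rw [← singularCohomology.map_comp, Homeomorph.symm_comp_toContinuousMap, singularCohomology.map_id]
  have htop : cupProduct (show 1 + 1 = 2 * 1 by norm_num)
      (cupMonomial (torusXi ℂ 2) 1 (id ∘ Fin.castSucc)) (torusXi ℂ 2 (Fin.last 1)) = torusTop ℂ 2 :=
    rfl
  refine ⟨singularCohomology.map ℂ ℂ (φ.symm : C(Y, Torus 2)) 1
      (cupMonomial (torusXi ℂ 2) 1 (id ∘ Fin.castSucc)),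
    singularCohomology.map ℂ ℂ (φ.symm : C(Y, Torus 2)) 1 (torusXi ℂ 2 (Fin.last 1)), ?_, ?_⟩
  · rw [← cupProduct_map, htop]
    intro h0
    apply torusTop_ne_zero (R := ℂ) 2
    have h := congrArg (singularCohomology.map ℂ ℂ (φ : C(Torus 2, Y)) (2 * 1)) h0
    rwa [map_zero, ← CategoryTheory.comp_apply, hid, CategoryTheory.id_apply] at h
  · rw [← cupProduct_map, htop]
    exact (isRationalClass_torusMonomial (n := 2) (k := 2) id).pullback _

/-- **A complex elliptic curve as an abelian variety, with `α ∪ β ≠ 0` rational in `H²`.** The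
Weierstrass cubic `E` of the lattice `ℤ + iℤ` with the chord–tangent group law is an abelian variety of
dimension `1` over `ℂ` (Silverman III.3.6; the tree's `WeierstrassCurve.abelianVarietyOfAddHom`), and
`E(ℂ) ≃ₜ ℂ/Λ = (ℝ/ℤ)²` (VI.3.6 (b), `PeriodPair.isHomeomorph_torusPoint`), so
`exists_cupProduct_ne_zero_of_homeomorph` applies.
[cite: SilvermanAEC2009, III.3.6 and VI.3.6 (b)] [cite: HatcherAT2002, §3.2 Example 3.16] -/
theorem exists_abelianVariety_dim_one_cupProduct_ne_zero :
    ∃ E : AbelianVariety ℂ, E.dim = 1 ∧ ∃ α β : complexBetti E.X 1,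
      cupProduct (show 1 + 1 = 2 * 1 by norm_num) α β ≠ 0 ∧
        IsRationalClass (cupProduct (show 1 + 1 = 2 * 1 by norm_num) α β) := by
  obtain ⟨L⟩ : Nonempty PeriodPair := ⟨⟨1, Complex.I, linearIndependent_one_I⟩⟩
  refine ⟨L.curve.abelianVarietyOfAddHom L.curve.addHom L.curve.negHom
    L.curve.lift_pointEquiv_comp_addHom L.curve.pointEquiv_comp_negHom_geom,
    schemeDim_eq_holds L.curve.isSmoothProjective_scheme, ?_⟩
  exact exists_cupProduct_ne_zero_of_homeomorph
    ((Literature.Geometry.Kaehler.ComplexTorus.toRealTorus L.periodIso).symm.trans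
      (IsHomeomorph.homeomorph L.torusPoint L.isHomeomorph_torusPoint))

end Curve

end Literature.AlgebraicGeometry.HodgeTheory

/-! ## The descent pair (namespace `Motives`) -/

namespace Literature.AlgebraicGeometry.Motives

open Literature.AlgebraicGeometry.HodgeTheory

/-! ### Künneth uniqueness: `fst^* x ∪ snd^* y ≠ 0` -/

section Kunneth

variable {ι : Type} [Fintype ι] [DecidableEq ι] (dg : ι → ℕ)
  {X' B' : Type} [TopologicalSpace X'] [TopologicalSpace B']

/-- The Leray–Hirsch comparison map on a family supported at ONE index `j₀`:
`θ(δ_{j₀} v) = q^* v ∪ c_{j₀}`. [folklore] -/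
theorem lhMap_single (q : C(X', B')) (c : (j : ι) → singularCohomology ℂ ℂ X' (dg j)) (k : ℕ)
    (j₀ : LerayHirsch.Idx dg k) (v : singularCohomology ℂ ℂ B' (k - dg j₀.1)) :
    LerayHirsch.lhMap ℂ dg q c k (Pi.single j₀ v) =
      cupProduct (Nat.sub_add_cancel j₀.2) (singularCohomology.map ℂ ℂ q (k - dg j₀.1) v) (c j₀.1) := by
  rw [LerayHirsch.lhMap_apply, Finset.sum_eq_single j₀.1]
  · rw [dif_pos j₀.2]
    change cupProduct _ (singularCohomology.map ℂ ℂ q _ ((Pi.single j₀ v : LerayHirsch.Src ℂ dg B' k) j₀))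
      (c j₀.1) = _
    rw [Pi.single_eq_same]
  · intro j _ hj
    split_ifs with h
    · have h0 : (Pi.single j₀ v : LerayHirsch.Src ℂ dg B' k) ⟨j, h⟩ = 0 :=
        Pi.single_eq_of_ne (fun e ↦ hj (congrArg Subtype.val e)) _
      rw [h0, map_zero, map_zero, LinearMap.zero_apply]
    · rfl
  · intro h
    exact absurd (Finset.mem_univ _) h

variable {m n : ℕ} {Y Z : SchemeOver ℂ}

/-- **Simple tensors survive Künneth**: for smooth projective `Y`, `Z` and non-zero classes
`x ∈ H^{k-q}(Y(ℂ); ℂ)`, `y ∈ H^q(Z(ℂ); ℂ)` (`q ≤ 2 dim Z`), `fst^* x ∪ snd^* y ≠ 0` in `Hᵏ((Y ⊗ Z)(ℂ); ℂ)`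
— the uniqueness half of the Künneth theorem (`complexBetti_kunneth_bijective`): expanding
`y = Σᵢ rᵢ bᵢ` in a basis of `H^q(Z(ℂ))`, `fst^* x ∪ snd^* y` is the image of the family `(rᵢ x)ᵢ`
(supported in degree `q`) under the bijective comparison map, and that family is non-zero.
[cite: HatcherAT2002, §3.2 Thm. 3.16] -/
theorem cupProduct_map_fst_map_snd_ne_zero (hY : IsSmoothProjective m Y) (hZ : IsSmoothProjective n Z)
    {k q : ℕ} (hqk : q ≤ k) (hq : q ≤ 2 * n) {x : complexBetti Y (k - q)} {y : complexBetti Z q}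
    (hx : x ≠ 0) (hy : y ≠ 0) :
    cupProduct (Nat.sub_add_cancel hqk) (complexBetti.map (fst Y Z) (k - q) x)
      (complexBetti.map (snd Y Z) q y) ≠ 0 := by
  classical
  haveI := fun j ↦ finite_complexBetti hZ j
  let σ : Fin (2 * n + 1) → Type := fun j ↦ Fin (Module.finrank ℂ (complexBetti Z j))
  let b : (j : Fin (2 * n + 1)) → Module.Basis (σ j) ℂ (complexBetti Z j) :=
    fun j ↦ Module.finBasis ℂ (complexBetti Z j)
  have hθ := complexBetti_kunneth_bijective hY hZ b k
  let q₀ : Fin (2 * n + 1) := ⟨q, by omega⟩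
  let dg : (Σ j : Fin (2 * n + 1), σ j) → ℕ := fun j ↦ (j.1 : ℕ)
  let J : σ q₀ → LerayHirsch.Idx dg k := fun i ↦ ⟨⟨q₀, i⟩, hqk⟩
  have hJ : Function.Injective J := fun i i' h ↦ by
    have h1 := congrArg (fun j : LerayHirsch.Idx dg k ↦ j.1) h
    exact eq_of_heq (Sigma.mk.inj h1).2
  set r : σ q₀ →₀ ℂ := (b q₀).repr y with hrdef
  set a : LerayHirsch.Src ℂ dg (ComplexPoints Y) k := ∑ i, Pi.single (J i) (r i • x) with hadef
  -- `θ a = fst^* x ∪ snd^* y`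
  have hterm : ∀ i, LerayHirsch.lhMap ℂ dg (AlgPoints.mapContinuous (L := ℂ) (fst Y Z))
      (fun j ↦ complexBetti.map (snd Y Z) (dg j) (b j.1 j.2)) k (Pi.single (J i) (r i • x)) =
      r i • cupProduct (Nat.sub_add_cancel hqk) (complexBetti.map (fst Y Z) (k - q) x)
        (complexBetti.map (snd Y Z) q (b q₀ i)) := fun i ↦ by
    rw [lhMap_single, map_smul, LinearMap.map_smul₂]
  have hexp : cupProduct (Nat.sub_add_cancel hqk) (complexBetti.map (fst Y Z) (k - q) x)
      (complexBetti.map (snd Y Z) q y) =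
      ∑ i, r i • cupProduct (Nat.sub_add_cancel hqk) (complexBetti.map (fst Y Z) (k - q) x)
        (complexBetti.map (snd Y Z) q (b q₀ i)) := by
    conv_lhs => rw [← (b q₀).sum_repr y]
    rw [map_sum, map_sum]
    refine Finset.sum_congr rfl fun i _ ↦ ?_
    rw [map_smul, map_smul]
  have hθa : LerayHirsch.lhMap ℂ dg (AlgPoints.mapContinuous (L := ℂ) (fst Y Z))
      (fun j ↦ complexBetti.map (snd Y Z) (dg j) (b j.1 j.2)) k a =
      cupProduct (Nat.sub_add_cancel hqk) (complexBetti.map (fst Y Z) (k - q) x)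
        (complexBetti.map (snd Y Z) q y) := by
    rw [hadef, map_sum, hexp]
    exact Finset.sum_congr rfl fun i _ ↦ hterm i
  intro h0
  -- injectivity: `a = 0`
  have ha : a = 0 := hθ.1 (by rw [hθa, h0, map_zero])
  -- read off the coordinates: `r i • x = 0` for all `i`
  have hcoord : ∀ i, r i • x = 0 := fun i ↦ by
    have h := congrFun ha (J i)
    rw [hadef, Finset.sum_apply, Finset.sum_eq_single i, Pi.single_eq_same, Pi.zero_apply] at h
    · exact h
    · intro i' _ hi'
      exact Pi.single_eq_of_ne (fun e ↦ hi' (hJ e).symm) _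
    · intro hi
      exact absurd (Finset.mem_univ _) hi
  have hr : r = 0 := by
    ext i
    exact (smul_eq_zero.1 (hcoord i)).resolve_right hx
  exact hy ((b q₀).repr.map_eq_zero_iff.1 (hrdef ▸ hr))

end Kunneth

/-! ### The descent pair on `E × E` -/

section Surface

variable {E : AbelianVariety ℂ} {d : ℕ}

/-- **The products of the Weil components with `snd^* ω` do not see the eigenvalue**: for
`u_t(a) = fst^* a + t · snd^* a` and `ω = α ∪ β` on a curve `E` (`H³(E(ℂ)) = 0`),
`(u_t(α) ∪ u_t(β)) ∪ snd^* ω = fst^* ω ∪ snd^* ω` — the two cross terms contain `snd^*(β ∪ ω)` resp.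
(after graded commutation in degree `1 × 1`) `snd^*(α ∪ ω)`, and the `t²`-term contains
`snd^*(ω ∪ ω)`, all in `snd^* H^{≥ 3}(E(ℂ)) = 0`. [folklore] -/
theorem cupProduct_weilComponent_map_snd (hdim : E.dim = 1) (t : ℂ) (α β : complexBetti E.X 1) :
    cupProduct (show 2 + 2 = 4 from rfl)
      (cupProduct (show 1 + 1 = 2 from rfl)
        (complexBetti.map (AbelianVariety.fst E E).hom.hom.hom 1 α +
          t • complexBetti.map (AbelianVariety.snd E E).hom.hom.hom 1 α)
        (complexBetti.map (AbelianVariety.fst E E).hom.hom.hom 1 β +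
          t • complexBetti.map (AbelianVariety.snd E E).hom.hom.hom 1 β))
      (complexBetti.map (AbelianVariety.snd E E).hom.hom.hom 2
        (cupProduct (show 1 + 1 = 2 from rfl) α β)) =
    cupProduct (show 2 + 2 = 4 from rfl)
      (complexBetti.map (AbelianVariety.fst E E).hom.hom.hom 2 (cupProduct (show 1 + 1 = 2 from rfl) α β))
      (complexBetti.map (AbelianVariety.snd E E).hom.hom.hom 2 (cupProduct (show 1 + 1 = 2 from rfl) α β)) := by
  have hE : IsSmoothProjective 1 E.X := by
    have h := (AbelianVariety.isSmoothProjective_holds (A := E))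
    change IsSmoothProjective E.dim E.X at h
    rwa [hdim] at h
  haveI h3 : Subsingleton (complexBetti E.X 3) := subsingleton_complexBetti hE (by norm_num)
  set F := complexBetti.map (AbelianVariety.fst E E).hom.hom.hom with hF
  set S := complexBetti.map (AbelianVariety.snd E E).hom.hom.hom with hS
  set ω := cupProduct (show 1 + 1 = 2 from rfl) α β with hω
  -- `v ∪ S ω = F β ∪ S ω` for `v = F β + t S β` (the `S β ∪ S ω = S (β ∪ ω) = 0` term dies)
  have hSβ : cupProduct (show 1 + 2 = 3 from rfl) (S 1 β) (S 2 ω) = 0 := by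
    rw [hS, ← cupProduct_map, Subsingleton.elim (cupProduct (show 1 + 2 = 3 from rfl) β ω) 0, map_zero]
  have hSα : cupProduct (show 1 + 2 = 3 from rfl) (S 1 α) (S 2 ω) = 0 := by
    rw [hS, ← cupProduct_map, Subsingleton.elim (cupProduct (show 1 + 2 = 3 from rfl) α ω) 0, map_zero]
  -- reassociate: `(u ∪ v) ∪ Sω = u ∪ (v ∪ Sω)`
  rw [cupProduct_assoc (show 1 + 1 = 2 from rfl) (show 1 + 2 = 3 from rfl) (show 2 + 2 = 4 from rfl)
    (show 1 + 3 = 4 from rfl)]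
  have hv : cupProduct (show 1 + 2 = 3 from rfl) (F 1 β + t • S 1 β) (S 2 ω) =
      cupProduct (show 1 + 2 = 3 from rfl) (F 1 β) (S 2 ω) := by
    rw [map_add, LinearMap.add_apply, map_smul, LinearMap.smul_apply, hSβ, smul_zero, add_zero]
  rw [hv, map_add, LinearMap.add_apply, map_smul, LinearMap.smul_apply]
  -- the cross term `S α ∪ (F β ∪ S ω) = (S α ∪ F β) ∪ S ω = -(F β ∪ S α) ∪ S ω = -F β ∪ (S α ∪ S ω) = 0`
  have hcross : cupProduct (show 1 + 3 = 4 from rfl) (S 1 α)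
      (cupProduct (show 1 + 2 = 3 from rfl) (F 1 β) (S 2 ω)) = 0 := by
    rw [← cupProduct_assoc (show 1 + 1 = 2 from rfl) (show 1 + 2 = 3 from rfl) (show 2 + 2 = 4 from rfl)
      (show 1 + 3 = 4 from rfl),
      cupProduct_gradedComm_holds ℂ _ (show 1 + 1 = 2 from rfl) (show 1 + 1 = 2 from rfl) (S 1 α) (F 1 β),
      map_smul, LinearMap.smul_apply,
      cupProduct_assoc (show 1 + 1 = 2 from rfl) (show 1 + 2 = 3 from rfl) (show 2 + 2 = 4 from rfl)
      (show 1 + 3 = 4 from rfl), hSα, map_zero, smul_zero]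
  rw [hcross, smul_zero, add_zero,
    ← cupProduct_assoc (show 1 + 1 = 2 from rfl) (show 1 + 2 = 3 from rfl) (show 2 + 2 = 4 from rfl)
      (show 1 + 3 = 4 from rfl), hF, ← cupProduct_map]

/-- **Schoen's partner surface with its descent pair, the dimension-one inputs abstracted.** Let `E`
be a complex abelian variety of dimension `1` with classes `α, β ∈ H¹(E(ℂ); ℂ)` whose cup product
`ω = α ∪ β` is non-zero and rational. Then for every `d` the surface `B = E × E` with
`ψ = (-(d • snd), fst)` (`ψ ≫ ψ = -d`) carries the descent pair `b_± = u_±(α) ∪ u_±(β)`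
(`(𝟙+ψ)^* b_± = (1 ± i√d)² b_±`, `b₊ + b₋ = 2·fst^*ω - 2d·snd^*ω` rational of Hodge type `(1,1)`) and
`η = snd^*ω ∈ N¹H²(B(ℂ))` (in print `[E × pt]`) with `b_± ⌣ η = fst^*ω ∪ snd^*ω ≠ 0`.
[cite: Schoen1998HodgeWeilAddendum, §10 (proof of the Proposition, p. 333)]
[cite: vanGeemen1994HodgeAV, 4.9 and Lemma 5.2 (6)] -/
theorem exists_descentPair_prod_self_of_dim_one (hdim : E.dim = 1) {α β : complexBetti E.X 1}
    (h0 : cupProduct (show 1 + 1 = 2 * 1 by norm_num) α β ≠ 0)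
    (hrat : IsRationalClass (cupProduct (show 1 + 1 = 2 * 1 by norm_num) α β)) (d : ℕ) :
    ∃ ψ : E.prod E ⟶ E.prod E, (E.prod E).dim = 2 ∧ ψ ≫ ψ = -((d : ℤ) • 𝟙 (E.prod E)) ∧
      ∃ bp bm η : complexBetti (E.prod E).X 2,
        bp ∈ Module.End.eigenspace (complexBetti.map (𝟙 (E.prod E) + ψ).hom.hom.hom 2).hom
              ((1 + Complex.I * (Real.sqrt (d : ℝ) : ℂ)) ^ 2) ∧
        bm ∈ Module.End.eigenspace (complexBetti.map (𝟙 (E.prod E) + ψ).hom.hom.hom 2).hom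
              ((1 - Complex.I * (Real.sqrt (d : ℝ) : ℂ)) ^ 2) ∧
        IsRationalClass (bp + bm) ∧ IsOfHodgeType 2 (E.prod E).X 2 1 1 (bp + bm) ∧
        η ∈ algebraicClasses (E.prod E).X 1 ∧
        cupProduct (show 2 + 2 = 4 from rfl) bp η ≠ 0 ∧
        cupProduct (show 2 + 2 = 4 from rfl) bm η ≠ 0 := by
  -- smooth projectivity and dimensions
  have hE : IsSmoothProjective 1 E.X := by
    have h := (AbelianVariety.isSmoothProjective_holds (A := E))
    change IsSmoothProjective E.dim E.X at h
    rwa [hdim] at h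
  have hBdim : (E.prod E).dim = 2 := by simp [AbelianVariety.dim_prod, hdim]
  have hB : IsSmoothProjective (2 * 1) (E.prod E).X := by
    have h := (AbelianVariety.isSmoothProjective_holds (A := E.prod E))
    change IsSmoothProjective (E.prod E).dim (E.prod E).X at h
    rwa [hBdim] at h
  -- the endomorphism `ψ = (-(d • snd), fst)`
  set ψ : E.prod E ⟶ E.prod E :=
    AbelianVariety.prodLift (-(d • AbelianVariety.snd E E)) (AbelianVariety.fst E E) with hψ
  have h₁ : ψ ≫ AbelianVariety.fst E E = -(d • AbelianVariety.snd E E) :=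
    AbelianVariety.prodLift_fst _ _
  have h₂ : ψ ≫ AbelianVariety.snd E E = AbelianVariety.fst E E := AbelianVariety.prodLift_snd _ _
  have hψψ : ψ ≫ ψ = -((d : ℤ) • 𝟙 (E.prod E)) := by
    rw [natCast_zsmul]
    apply AbelianVariety.prod_hom_ext
    · rw [Category.assoc, h₁, Preadditive.comp_neg, Preadditive.comp_nsmul, h₂, Preadditive.neg_comp,
        Preadditive.nsmul_comp, Category.id_comp]
    · rw [Category.assoc, h₂, h₁, Preadditive.neg_comp, Preadditive.nsmul_comp, Category.id_comp]
  -- notation for the pull-backs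
  have h12 : 1 + 1 = 2 * 1 := by norm_num
  set pF := complexBetti.map (AbelianVariety.fst E E).hom.hom.hom with hpF
  set pS := complexBetti.map (AbelianVariety.snd E E).hom.hom.hom with hpS
  set ν : ℂ := Complex.I * (Real.sqrt d : ℂ) with hνdef
  have hν : ν * ν = -(d : ℂ) := I_mul_sqrt_mul_self d
  have hν' : (-ν) * (-ν) = -(d : ℂ) := by rw [neg_mul_neg, hν]
  -- the Weil components `b_± = u_±(α) ∪ u_±(β)` are simultaneous eigenclasses
  have hu : ∀ {t : ℂ}, t * t = -(d : ℂ) → ∀ a : complexBetti E.X 1,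
      pF 1 a + t • pS 1 a ∈ pullbackEigenclasses (E.prod E) ψ 1 fun x y ↦ (x : ℂ) + (y : ℂ) * t :=
    fun ht a ↦ map_fst_add_smul_map_snd_mem_pullbackEigenclasses h₁ h₂ ht a
  have hcomp : ∀ {t : ℂ}, t * t = -(d : ℂ) →
      cupProduct h12 (pF 1 α + t • pS 1 α) (pF 1 β + t • pS 1 β) ∈
        pullbackEigenclasses (E.prod E) ψ (2 * 1)
          fun x y ↦ ((x : ℂ) + (y : ℂ) * t) * ((x : ℂ) + (y : ℂ) * t) :=
    fun ht ↦ cupProduct_mem_pullbackEigenclasses h12 (hu ht α) (hu ht β)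
  -- … hence eigenvectors of the single test endomorphism `(𝟙 + ψ)^*` for `(1 + t)²`
  have heig : ∀ {t : ℂ}, t * t = -(d : ℂ) →
      cupProduct h12 (pF 1 α + t • pS 1 α) (pF 1 β + t • pS 1 β) ∈
        Module.End.eigenspace (complexBetti.map (𝟙 (E.prod E) + ψ).hom.hom.hom 2).hom ((1 + t) ^ 2) := by
    intro t ht
    rw [Module.End.mem_eigenspace_iff]
    have h := (mem_pullbackEigenclasses_iff.mp (hcomp ht)) 1 1
    rw [one_smul, one_smul] at h
    push_cast at h
    rw [one_mul, ← sq] at h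
    exact h
  -- the closed form `b₊ + b₋ = 2·fst^* ω - 2d·snd^* ω`
  set ω := cupProduct h12 α β with hω
  have hb : cupProduct h12 (pF 1 α + ν • pS 1 α) (pF 1 β + ν • pS 1 β) +
      cupProduct h12 (pF 1 α + (-ν) • pS 1 α) (pF 1 β + (-ν) • pS 1 β) =
      (2 : ℂ) • pF (2 * 1) ω + (2 * -(d : ℂ)) • pS (2 * 1) ω := by
    rw [bilin_add_bilin_neg (cupProduct h12) ν, hν, hω, hpF, hpS, cupProduct_map, cupProduct_map]
  -- `fst^* ω ∪ snd^* ω ≠ 0` (Künneth uniqueness)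
  have hFS : cupProduct (show 2 + 2 = 4 from rfl) (pF 2 ω) (pS 2 ω) ≠ 0 :=
    cupProduct_map_fst_map_snd_ne_zero (Y := E.X) (Z := E.X) hE hE (k := 4) (q := 2) (by norm_num)
      (by norm_num) h0 h0
  refine ⟨ψ, hBdim, hψψ, cupProduct h12 (pF 1 α + ν • pS 1 α) (pF 1 β + ν • pS 1 β),
    cupProduct h12 (pF 1 α + (-ν) • pS 1 α) (pF 1 β + (-ν) • pS 1 β), pS 2 ω, ?_, ?_, ?_, ?_, ?_, ?_, ?_⟩
  · -- `b₊ ∈ Eig((𝟙+ψ)^*, (1 + i√d)²)`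
    exact heig hν
  · -- `b₋ ∈ Eig((𝟙+ψ)^*, (1 - i√d)²)`
    have h := heig hν'
    rwa [← sub_eq_add_neg] at h
  · -- rationality of `b₊ + b₋`
    rw [hb]
    have e2 : (2 * -(d : ℂ)) = ((-(2 * d) : ℚ) : ℂ) := by push_cast; ring
    have e1 : (2 : ℂ) = ((2 : ℚ) : ℂ) := by norm_num
    rw [e2, e1]
    exact ((hrat.pullback (Motives.AlgPoints.mapContinuous (L := ℂ)
      (AbelianVariety.fst E E).hom.hom.hom)).smul 2).add
      ((hrat.pullback (Motives.AlgPoints.mapContinuous (L := ℂ)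
        (AbelianVariety.snd E E).hom.hom.hom)).smul _)
  · -- Hodge type `(1, 1)` of `b₊ + b₋`
    rw [hb]
    obtain ⟨A⟩ := nonempty_hodgeModel_holds (n := 1) (X := E.X) hE
    have hωH : IsOfHodgeType 1 E.X (2 * 1) 1 1 ω := isOfHodgeType_of_degree_eq_two_mul A ω
    exact ((hωH.map_of_isSmoothProjective hB hE (AbelianVariety.fst E E).hom.hom.hom).smul 2).add hB
      ((hωH.map_of_isSmoothProjective hB hE (AbelianVariety.snd E E).hom.hom.hom).smul _)
  · -- `η = snd^* ω` is algebraic: `ω ∈ N¹H²(E)` (top degree) and `snd` is flat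
    have hωalg : ω ∈ algebraicClasses E.X 1 := mem_algebraicClasses_of_degree_top hE le_rfl ω
    haveI : Flat (AbelianVariety.snd E E).hom.hom.hom.left :=
      inferInstanceAs (Flat (Limits.pullback.snd E.X.hom E.X.hom))
    exact map_mem_algebraicClasses_of_flat (AbelianVariety.snd E E).hom.hom.hom hωalg
  · -- `b₊ ⌣ η = fst^*ω ∪ snd^*ω ≠ 0`
    rw [hω, hpF, hpS, cupProduct_weilComponent_map_snd hdim ν α β]
    exact hFS
  · -- `b₋ ⌣ η = fst^*ω ∪ snd^*ω ≠ 0`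
    rw [hω, hpF, hpS, cupProduct_weilComponent_map_snd hdim (-ν) α β]
    exact hFS

end Surface

/-! ### A Weil surface with a descent pair, for every `d` -/

/-- **A Weil surface with a descent pair exists for every `d`**, in the typing of the surface
conjunct of `exists_cmWeilSurface_aimedSplitProduct`: a complex abelian surface `B` with `ψ ≫ ψ = -d`,
classes `b₊ ∈ Eig((𝟙+ψ)^*, (1+i√d)²)`, `b₋ ∈ Eig((𝟙+ψ)^*, (1-i√d)²)` with `b₊ + b₋` rational of Hodge
type `(1,1)`, and an algebraic `η ∈ N¹H²(B(ℂ))` with `b₊ ⌣ η ≠ 0`, `b₋ ⌣ η ≠ 0` (the cohomological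
content of Schoen's partner surface `A'`: "`W_{A'}` has Hodge type `(1,1)`", "`W_{A'}` is generated
by cohomology classes of divisors", "`ω_{5,σ₁} ∧ ω_{6,σ₁} ∧ ω_{5,σ₂} ∧ ω_{6,σ₂}` is a basis for
`H⁴(A'; ℂ)`"). Witness: `B = E × E` for the Weierstrass cubic `E` of `ℤ + iℤ`,
`ψ = (-(d • snd), fst)` (companion matrix, no complex multiplication used), `b_± = u_±(α) ∪ u_±(β)`,
`η = snd^*(α ∪ β)` (`exists_descentPair_prod_self_of_dim_one`,
`HodgeTheory.exists_abelianVariety_dim_one_cupProduct_ne_zero`). Not shown to serve the aiming half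
(module docstring, CAVEAT). Relies on: nothing unproved.
[cite: Schoen1998HodgeWeilAddendum, §10 (proof of the Proposition, p. 333)]
[cite: vanGeemen1994HodgeAV, 4.9 and Lemma 5.2 (6)] -/
theorem exists_weilSurface_descentPair (d : ℕ) :
    ∃ (B : AbelianVariety ℂ) (ψ : B ⟶ B), B.dim = 2 ∧ ψ ≫ ψ = -((d : ℤ) • 𝟙 B) ∧
      ∃ bp bm η : complexBetti B.X 2,
        bp ∈ Module.End.eigenspace (complexBetti.map (𝟙 B + ψ).hom.hom.hom 2).hom
              ((1 + Complex.I * (Real.sqrt (d : ℝ) : ℂ)) ^ 2) ∧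
        bm ∈ Module.End.eigenspace (complexBetti.map (𝟙 B + ψ).hom.hom.hom 2).hom
              ((1 - Complex.I * (Real.sqrt (d : ℝ) : ℂ)) ^ 2) ∧
        IsRationalClass (bp + bm) ∧ IsOfHodgeType 2 B.X 2 1 1 (bp + bm) ∧
        η ∈ algebraicClasses B.X 1 ∧
        cupProduct (show 2 + 2 = 4 from rfl) bp η ≠ 0 ∧
        cupProduct (show 2 + 2 = 4 from rfl) bm η ≠ 0 := by
  obtain ⟨E, hdim, α, β, h0, hrat⟩ := exists_abelianVariety_dim_one_cupProduct_ne_zero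
  obtain ⟨ψ, hBdim, hψψ, h⟩ := exists_descentPair_prod_self_of_dim_one hdim h0 hrat d
  exact ⟨E.prod E, ψ, hBdim, hψψ, h⟩

end Literature.AlgebraicGeometry.Motives

end
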